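import Summits.HodgeConjecture.HodgeConjecture.Theses.MilnorKExponential
import Literature.AlgebraicGeometry.HodgeTheory.SymbolClasses
import Literature.AlgebraicGeometry.HodgeTheory.SupportedHodgeClassesAlgebraic
import Literature.AlgebraicGeometry.HodgeTheory.SaitoGrFDeRhamCurveNetHolds
import Literature.AlgebraicGeometry.HodgeTheory.GysinKernelProofs
import Literature.AlgebraicGeometry.Resolution.ProjectiveResolutionProofs
import Literature.AlgebraicGeometry.HodgeTheory.ComplexOrientationFamily
import Literature.AlgebraicGeometry.HodgeTheory.LefschetzOneOneHolds

/-!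
# Census artefact (crux-strategist `cstrat-stmt-HodgeConjecture-17743`): the coniveau ladder for
symbol classes — the best TYPED DECOMPOSITION of the crux `SymbolClassesAlgebraic` (GK) found

Crux (route `MilnorKExponential`, item stmt-HodgeConjecture-17743): GK_p — every rational symbol
class of weight `p = q + 1` on a smooth projective complex variety is algebraic, i.e. lies in
`algebraicClasses X (q+1) = N^{q+1} H^{2q+2}` (the tree's space of algebraic classes IS the top step
of Grothendieck's coniveau filtration `supportedClasses`).

This file PROVES (sorry-free):

* `gkNamed_of_route`, `route_of_gkNamed`, `liftNamed_of_route`, `hodgeTypeNamed_of_route` — the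
  inlined route items `SymbolClassesAlgebraic` / `SymbolLiftR` / `SymbolClassesHodgeType` in NAMED
  form over `IsSymbolClass` / `HodgeModel.IsSymbolNormalized` / `HodgeModel.HasSymbolCocycle` of
  `Literature/AlgebraicGeometry/HodgeTheory/SymbolClasses` (componentwise definitional; the only
  non-`rfl` point is the bundling of the two cocycle conditions into `IsMilnorSymbolCocycle`, and
  the `Nontrivial` guard of `IsSymbolClass`, void for `c ≠ 0`).
* The decomposition  GK ⇐ `SymbolConiveauOne` ∧ `SymbolGysinLift`  (`gkNamed_of_ladder`,
  strong induction on the weight; base weight `1`: `N¹H² = algebraicClasses X 1` by definition):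
  - `SymbolConiveauOne` (Sub₁): every rational symbol class has coniveau `≥ 1`
    (`∈ supportedClasses X (2(q+1)) 1`), the symbol version of the crux `HodgeClassesConiveauOne`
    of route `HolomorphicDefect`;
  - `SymbolGysinLift` (Sub₂): a rational symbol class of weight `q + 2` dying off the joint image of
    finitely many `gⱼ : Yⱼ ⟶ X` (smooth projective) is a `ℂ`-combination of Gysin images
    `(gⱼ)_* b` of rational SYMBOL classes `b` of lower weight on the `Yⱼ` (plus degree-`0` classes).
* `symbolGysinLift_of_lift`: Sub₂ FOLLOWS from the route's own items `SymbolClassesHodgeType`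
  (support, `L ⊆ Hdg`) and `SymbolLiftR` (crux #3, LIFT) on the lower-dimensional `Yⱼ`, by Deligne
  descent (Hodge III, Cor. 8.2.8) and the lifting of Hodge classes along Gysin surjections
  (Voisin 2025, Cor. 2.12) — both discharged tree facts.
* Hence `symbolClassesAlgebraic_of_coniveauOne`:
  `SymbolClassesHodgeType → SymbolLiftR → SymbolConiveauOne → SymbolClassesAlgebraic`, and conversely
  `symbolConiveauOne_of_gk` : GK → Sub₁ (`N^{q+1} ≤ N¹`). So, GIVEN the route's other crux LIFT, the
  residual content of GK is exactly Sub₁ = "symbol classes die on the complement of a divisor";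
  in weight `2` (the first open case `(n, p) = (4, 2)`) Sub₁ is GK₂ itself (Voisin 2013 Lemma 2.1
  with `p = 1`, tree `supportedHodgeClass_algebraic_of_facts`), which is why this split is recorded
  in the STRATEGY CENSUS (heading Decomposition) and not filed as a redirect: its hard half has no
  plan short of the summit.

References: Voisin 2013 (arXiv:1107.2600) Lemma 2.1; Deligne, Hodge III, Cor. 8.2.8; Voisin 2025,
Cor. 2.12; Grothendieck, Topology 8 (1969); Bloch, Lectures on Algebraic Cycles, Lecture 6, p. 72.
-/

noncomputable section

open scoped Manifold
open CategoryTheory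

namespace Summit.HodgeConjecture.HodgeConjecture.Cruxes.SymbolClassesAlgebraic.Census

open Literature.AlgebraicGeometry Literature.AlgebraicGeometry.HodgeTheory
  Literature.AlgebraicGeometry.Motives Literature.Geometry.Kaehler
  Literature.AlgebraicTopology.SingularHomology

set_option linter.dupNamespace false

/-! ### Named forms of the route items -/

/-- GK in named, GUARDED form (`IsSymbolClass`). -/
def GKNamed : Prop :=
  ∀ ⦃n : ℕ⦄ ⦃X : SchemeOver ℂ⦄, IsSmoothProjective n X →
    ∀ (q : ℕ) (c : complexBetti X (2 * (q + 1))), IsRationalClass c → IsSymbolClass n X q c →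
      c ∈ algebraicClasses X (q + 1)

/-- LIFT (repaired, `q + 1 ≤ n`) in named form. -/
def LiftNamed : Prop :=
  ∀ ⦃n : ℕ⦄ ⦃X : SchemeOver ℂ⦄, IsSmoothProjective n X →
    ∀ (q : ℕ), q + 1 ≤ n → ∀ (c : complexBetti X (2 * (q + 1))), IsRationalClass c →
      IsOfHodgeType n X (2 * (q + 1)) (q + 1) (q + 1) c →
        ∃ A : HodgeModel n X, A.IsSymbolNormalized q ∧ A.HasSymbolCocycle q c

/-- `L ⊆ Hdg` in named (guarded) form. -/
def HodgeTypeNamed : Prop :=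
  ∀ ⦃n : ℕ⦄ ⦃X : SchemeOver ℂ⦄, IsSmoothProjective n X →
    ∀ (q : ℕ) (c : complexBetti X (2 * (q + 1))), IsRationalClass c → IsSymbolClass n X q c →
        IsOfHodgeType n X (2 * (q + 1)) (q + 1) (q + 1) c

/-- route GK ⇒ named GK. -/
theorem gkNamed_of_route (h : Theses.MilnorKExponential.SymbolClassesAlgebraic) : GKNamed := by
  intro n X hX q c hc hs
  by_cases hc0 : c = 0
  · rw [hc0]; exact Submodule.zero_mem _
  obtain ⟨A, hN, hS⟩ := hs.exists_isSymbolNormalized hc0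
  obtain ⟨ι, hι, U, hU, hcov, σ, ⟨hg, hco⟩, θ, m, hm, hT, hdR⟩ := hS
  exact h hX q c hc ⟨A, hN, ι, hι, U, hU, hcov, σ, hg, hco, θ, m, hm, hT, hdR⟩

/-- named GK ⇒ route GK. -/
theorem route_of_gkNamed (h : GKNamed) : Theses.MilnorKExponential.SymbolClassesAlgebraic := by
  intro n X hX q c hc hs
  obtain ⟨A, hN, ι, hι, U, hU, hcov, σ, hg, hco, θ, m, hm, hT, hdR⟩ := hs
  exact h hX q c hc ⟨A, fun _ ↦ hN, ι, hι, U, hU, hcov, σ, ⟨hg, hco⟩, θ, m, hm, hT, hdR⟩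

/-- route LIFT ⇒ named LIFT. -/
theorem liftNamed_of_route (h : Theses.MilnorKExponential.SymbolLiftR) : LiftNamed := by
  intro n X hX q hq c hc hc'
  obtain ⟨A, hN, ι, hι, U, hU, hcov, σ, hg, hco, θ, m, hm, hT, hdR⟩ := h hX q hq c hc hc'
  exact ⟨A, hN, ι, hι, U, hU, hcov, σ, ⟨hg, hco⟩, θ, m, hm, hT, hdR⟩

/-- route HodgeType ⇒ named HodgeType. -/
theorem hodgeTypeNamed_of_route (h : Theses.MilnorKExponential.SymbolClassesHodgeType) :
    HodgeTypeNamed := by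
  intro n X hX q c hc hs
  by_cases hc0 : c = 0
  · obtain ⟨A⟩ := hs.nonempty_hodgeModel
    rw [hc0]; exact IsOfHodgeType.zero A _ _ _
  obtain ⟨A, hN, hS⟩ := hs.exists_isSymbolNormalized hc0
  obtain ⟨ι, hι, U, hU, hcov, σ, ⟨hg, hco⟩, θ, m, hm, hT, hdR⟩ := hS
  exact h hX q c hc ⟨A, hN, ι, hι, U, hU, hcov, σ, hg, hco, θ, m, hm, hT, hdR⟩

/-! ### The two pieces of the ladder -/

/-- **Sub₁ — coniveau one for symbol classes**: on a smooth projective complex variety every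
rational symbol class of weight `q + 1` dies on the complement of a proper Zariski-closed subset,
i.e. lies in `N¹ H^{2q+2} = supportedClasses X (2(q+1)) 1`. (Weakest unknown consequence of GK:
`algebraicClasses X (q+1) = N^{q+1} ≤ N¹`, `symbolConiveauOne_of_gk`.) -/
def SymbolConiveauOne : Prop :=
  ∀ ⦃n : ℕ⦄ ⦃X : SchemeOver ℂ⦄, IsSmoothProjective n X →
    ∀ (q : ℕ) (c : complexBetti X (2 * (q + 1))), IsRationalClass c → IsSymbolClass n X q c →
      c ∈ supportedClasses X (2 * (q + 1)) 1

/-- **Sub₂ — symbol classes lift along Gysin maps as symbol classes**: for `X` smooth projective of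
dimension `n`, a finite family `gⱼ : Yⱼ ⟶ X` from smooth projective `Yⱼ` of dimensions `mⱼ`, and a
rational symbol class `c` of weight `q + 2` dying on `(X ∖ ⋃ⱼ gⱼ(Yⱼ))(ℂ)`, the class `c` is a
`ℂ`-combination of Gysin images `(gⱼ)_* b` with `b` a RATIONAL SYMBOL class of weight `d + 1` on
`Yⱼ` (`2(d+1) + 2n = 2(q+2) + 2mⱼ`) or a rational degree-`0` class (`2n = 2(q+2) + 2mⱼ`). The
Hodge-class analogue is Deligne descent + Voisin 2025 Cor. 2.12 (tree facts); with SYMBOL in place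
of HODGE it follows from them plus `L ⊆ Hdg` and LIFT on the `Yⱼ` (`symbolGysinLift_of_lift`). -/
def SymbolGysinLift : Prop :=
  ∀ (μ : OrientationFamily), μ.HasPoincareDuality →
    ∀ ⦃n : ℕ⦄ ⦃X : SchemeOver ℂ⦄ (hX : IsSmoothProjective n X)
      ⦃ι : Type⦄ [Finite ι] ⦃m : ι → ℕ⦄ ⦃Y : ι → SchemeOver ℂ⦄
      (hY : ∀ j, IsSmoothProjective (m j) (Y j)) (g : ∀ j, Y j ⟶ X) (q : ℕ)
      ⦃c : complexBetti X (2 * (q + 1 + 1))⦄, IsRationalClass c → IsSymbolClass n X (q + 1) c →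
      complexBetti.restrictCompl X (⋃ j, Set.range (g j).left.base) (2 * (q + 1 + 1)) c = 0 →
      c ∈ (⨆ (j : ι) (d : ℕ) (hd : 2 * (d + 1) + 2 * n = 2 * (q + 1 + 1) + 2 * m j),
            (Submodule.span ℂ {b : complexBetti (Y j) (2 * (d + 1)) |
                IsRationalClass b ∧ IsSymbolClass (m j) (Y j) d b}).map
              (complexGysin μ (hY j) hX (g j) hd)) ⊔
          (⨆ (j : ι) (hd : 2 * 0 + 2 * n = 2 * (q + 1 + 1) + 2 * m j),
            (Submodule.span ℂ {b : complexBetti (Y j) (2 * 0) | IsRationalClass b}).map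
              (complexGysin μ (hY j) hX (g j) hd))

/-! ### GK ⇒ Sub₁ -/

/-- GK implies Sub₁ (`N^{q+1} ≤ N¹`). -/
theorem symbolConiveauOne_of_gkNamed (h : GKNamed) : SymbolConiveauOne :=
  fun _ X hX q c hc hs ↦ supportedClasses_mono (X := X) (2 * (q + 1)) (by omega) (h hX q c hc hs)

theorem symbolConiveauOne_of_gk (h : Theses.MilnorKExponential.SymbolClassesAlgebraic) :
    SymbolConiveauOne :=
  symbolConiveauOne_of_gkNamed (gkNamed_of_route h)

/-! ### The ladder: Sub₁ ∧ Sub₂ ⇒ GK (strong induction on the weight) -/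

/-- **The coniveau ladder.** From the facts projective Hironaka (`hH`, to resolve the components of
the support produced by Sub₁) and Gysin/restriction compatibility (`hS`, Gysin images of algebraic
classes are algebraic), Sub₁ and Sub₂ imply GK: a rational symbol class of weight `q + 2` dies off a
proper closed `Z` (Sub₁), `Z = ⋃ⱼ gⱼ(Yⱼ)` with `Yⱼ` smooth projective of dimension `< n` (`hH`), so
`c = Σ (gⱼ)_* b` with `b` rational symbol classes of weight `≤ q + 1` (Sub₂), algebraic by
induction, and Gysin images of algebraic classes are algebraic (`hS`); weight `1`: `N¹H² = Alg¹`. -/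
theorem gkNamed_of_ladder (hH : Resolution.Hironaka1964_projective.{0})
    (hS : gysinMap_restrictCompl_eq_zero.{0, 0} ℂ) (μ : OrientationFamily)
    (hμ : μ.HasPoincareDuality) (h1 : SymbolConiveauOne) (h2 : SymbolGysinLift) : GKNamed := by
  suffices H : ∀ q q', q' ≤ q → ∀ ⦃n : ℕ⦄ ⦃X : SchemeOver ℂ⦄, IsSmoothProjective n X →
      ∀ (c : complexBetti X (2 * (q' + 1))), IsRationalClass c → IsSymbolClass n X q' c →
        c ∈ algebraicClasses X (q' + 1) from
    fun n X hX q c hc hs ↦ H q q le_rfl hX c hc hs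
  intro q
  induction q with
  | zero =>
    intro q' hq' n X hX c hc hs
    obtain rfl : q' = 0 := Nat.le_zero.mp hq'
    exact h1 hX 0 c hc hs
  | succ q ih =>
    intro q' hq' n X hX c hc hs
    rcases Nat.lt_or_ge q' (q + 1) with hlt | hge
    · exact ih q' (Nat.lt_succ_iff.mp hlt) hX c hc hs
    obtain rfl : q' = q + 1 := le_antisymm hq' hge
    -- Sub₁: `c` dies off a proper closed subset `Z`, resolved into `⋃ⱼ gⱼ(Yⱼ)` (Hironaka)
    obtain ⟨Z, hZ, hr, h0⟩ := exists_support_of_mem_supportedClasses (h1 hX (q + 1) c hc hs)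
    obtain ⟨ι, hι, m, Y, hY, g, hZg, hm⟩ := exists_family_iUnion_range_eq_of_isClosed hH hX hZ hr
    haveI := hι
    rw [← hZg] at h0
    -- Sub₂: `c` is a combination of Gysin images of lower-weight symbol classes
    have key := h2 μ hμ hX hY g q hc hs h0
    refine SetLike.le_def.1 (sup_le ?_ ?_) key
    · refine iSup_le fun j ↦ iSup_le fun d ↦ iSup_le fun hd ↦ ?_
      rw [Submodule.map_le_iff_le_comap, Submodule.span_le]
      rintro b ⟨hb, hsb⟩
      rw [SetLike.mem_coe, Submodule.mem_comap]
      have hmj := hm j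
      have hba : b ∈ algebraicClasses (Y j) (d + 1) := ih d (by omega) (hY j) b hb hsb
      exact complexGysin_mem_supportedClasses hS μ hμ (hY j) hX (g j) hd (r := d + 1)
        (s := q + 1 + 1) (by omega) hba
    · refine iSup_le fun j ↦ iSup_le fun hd ↦ ?_
      rw [Submodule.map_le_iff_le_comap, Submodule.span_le]
      rintro b -
      rw [SetLike.mem_coe, Submodule.mem_comap]
      have hb0 : b ∈ supportedClasses (Y j) (2 * 0) 0 := by
        rw [supportedClasses_zero]; exact Submodule.mem_top
      exact complexGysin_mem_supportedClasses hS μ hμ (hY j) hX (g j) hd (r := 0)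
        (s := q + 1 + 1) (by omega) hb0

/-! ### Sub₂ from `L ⊆ Hdg` and LIFT in lower dimension -/

/-- **Sub₂ is implied by the route's own items**: from Deligne descent (`hA`, Hodge III 8.2.8) and
the lifting of Hodge classes along Gysin surjections (`hB`, Voisin 2025 Cor. 2.12), a rational
symbol class of weight `q + 2` dying off `⋃ⱼ gⱼ(Yⱼ)` is — being of Hodge type `(q+2, q+2)` by
`L ⊆ Hdg` — a combination of `(gⱼ)_* b` with `b` rational of type `(d, d)` on `Yⱼ`; for `d ≥ 1`
such `b` is a symbol class by LIFT on `Yⱼ` (`d ≤ dim Yⱼ` automatically when `q + 2 ≤ n`; above the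
dimension `c = 0`). -/
theorem symbolGysinLift_of_lift (hA : Deligne1974_ker_restrictCompl_eq_iSup_range_complexGysin)
    (hB : Voisin2025_hodgeClass_lift_complexGysin) (hT : HodgeTypeNamed) (hL : LiftNamed) :
    SymbolGysinLift := by
  intro μ hμ n X hX ι _ m Y hY g q c hc hs h0
  have hc' : IsOfHodgeType n X (2 * (q + 1 + 1)) (q + 1 + 1) (q + 1 + 1) c := hT hX (q + 1) c hc hs
  rcases Nat.lt_or_ge n (q + 1 + 1) with hn | hn
  · rw [IsOfHodgeType.eq_zero_pp_of_lt hc' hn]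
    exact Submodule.zero_mem _
  have hmem := Voisin2025_hodgeClass_lift_complexGysin.mem_iSup_map_of_restrictCompl_eq_zero
    hA hB μ hμ hX hY g rfl hc hc' h0
  refine SetLike.le_def.1 (iSup_le fun j ↦ iSup_le fun d ↦ iSup_le fun hd ↦ ?_) hmem
  rcases d with _ | d
  · refine le_sup_of_le_right (le_iSup_of_le j (le_iSup_of_le hd (Submodule.map_mono ?_)))
    exact Submodule.span_mono fun b hb ↦ hb.1
  · refine le_sup_of_le_left (le_iSup_of_le j (le_iSup_of_le d (le_iSup_of_le hd
      (Submodule.map_mono (Submodule.span_mono fun b hb ↦ ⟨hb.1, ?_⟩)))))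
    have hdm : d + 1 ≤ m j := by omega
    obtain ⟨A, hN, hS⟩ := hL (hY j) d hdm b hb.1 hb.2
    exact ⟨A, fun _ ↦ hN, hS⟩

/-! ### Assembly of the census statement -/

/-- **GK's residual content, given the route's LIFT, is coniveau one for symbol classes**:
`SymbolClassesHodgeType → SymbolLiftR → SymbolConiveauOne → SymbolClassesAlgebraic`, all facts
discharged in the tree (Deligne 8.2.8, Voisin 2025 Cor. 2.12, projective Hironaka, Gysin support,
Poincaré duality of the complex orientation family). -/
theorem symbolClassesAlgebraic_of_coniveauOne
    (hT : Theses.MilnorKExponential.SymbolClassesHodgeType)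
    (hL : Theses.MilnorKExponential.SymbolLiftR) (h1 : SymbolConiveauOne) :
    Theses.MilnorKExponential.SymbolClassesAlgebraic :=
  route_of_gkNamed <|
    gkNamed_of_ladder Resolution.Hironaka1964_projective_holds
      (gysinMap_restrictCompl_eq_zero_of_field ℂ) complexOrientationFamily
      (OrientationFamily.hasPoincareDuality _) h1
      (symbolGysinLift_of_lift Deligne1974_ker_restrictCompl_eq_iSup_range_complexGysin_holds
        Voisin2025_hodgeClass_lift_complexGysin_holds (hodgeTypeNamed_of_route hT)
        (liftNamed_of_route hL))

/-- The same with Sub₂ kept abstract: `Sub₁ → Sub₂ → GK` (route form). -/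
theorem symbolClassesAlgebraic_of_subs (h1 : SymbolConiveauOne) (h2 : SymbolGysinLift) :
    Theses.MilnorKExponential.SymbolClassesAlgebraic :=
  route_of_gkNamed <|
    gkNamed_of_ladder Resolution.Hironaka1964_projective_holds
      (gysinMap_restrictCompl_eq_zero_of_field ℂ) complexOrientationFamily
      (OrientationFamily.hasPoincareDuality _) h1 h2

/-! ### Census / TRANSFER: the solved siblings are literally in the tree

GK is known exactly where HC is known. Given `L ⊆ Hdg` (support item), the tree proves GK in
weight `1` (Lefschetz `(1,1)`, the GAGA/Pic sibling), in dimension `≤ 3` (Voisin II, Prop. 10.26)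
and above the dimension (`H^{2p} = 0`). The first open slice is `n = 4`, weight `2`. -/

/-- Weight one: GK₁ = Lefschetz `(1,1)` (given `L ⊆ Hdg`). -/
theorem gkNamed_weight_one (hT : HodgeTypeNamed) ⦃n : ℕ⦄ ⦃X : SchemeOver ℂ⦄
    (hX : IsSmoothProjective n X) (c : complexBetti X (2 * (0 + 1))) (hc : IsRationalClass c)
    (hs : IsSymbolClass n X 0 c) : c ∈ algebraicClasses X (0 + 1) :=
  lefschetzOneOne_rational_holds hX c hc (hT hX 0 c hc hs)

/-- Dimension `≤ 3`: GK holds in every weight (given `L ⊆ Hdg`), by HC for `dim ≤ 3`. -/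
theorem gkNamed_of_dim_le_three (hT : HodgeTypeNamed) ⦃n : ℕ⦄ ⦃X : SchemeOver ℂ⦄ (hn : n ≤ 3)
    (hX : IsSmoothProjective n X) (q : ℕ) (c : complexBetti X (2 * (q + 1)))
    (hc : IsRationalClass c) (hs : IsSymbolClass n X q c) : c ∈ algebraicClasses X (q + 1) :=
  (hodgeConjectureFor_of_dim_le_three_holds hn hX).2 (q + 1) c hc (hT hX q c hc hs)

/-- Above the dimension: a symbol class of weight `> dim X` is `0` (given `L ⊆ Hdg`). -/
theorem gkNamed_above_dim (hT : HodgeTypeNamed) ⦃n : ℕ⦄ ⦃X : SchemeOver ℂ⦄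
    (hX : IsSmoothProjective n X) (q : ℕ) (hq : n < q + 1) (c : complexBetti X (2 * (q + 1)))
    (hc : IsRationalClass c) (hs : IsSymbolClass n X q c) : c ∈ algebraicClasses X (q + 1) := by
  rw [IsOfHodgeType.eq_zero_pp_of_lt (hT hX q c hc hs) hq]
  exact Submodule.zero_mem _

/-- **Weight two is coniveau one**: in weight `2` (every dimension) Sub₁ already gives GK₂ —
a rational `(2,2)`-class of coniveau `≥ 1` is algebraic (Voisin 2013, Lemma 2.1 with `p = 1`,
tree `supportedHodgeClass_algebraic_of_facts`, all facts discharged). This is why the ladder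
has no leverage in the first open case `(n, p) = (4, 2)`. -/
theorem gkNamed_weight_two_of_coniveauOne (hT : HodgeTypeNamed) (h1 : SymbolConiveauOne)
    ⦃n : ℕ⦄ ⦃X : SchemeOver ℂ⦄ (hX : IsSmoothProjective n X) (c : complexBetti X (2 * (1 + 1)))
    (hc : IsRationalClass c) (hs : IsSymbolClass n X 1 c) : c ∈ algebraicClasses X (1 + 1) :=
  supportedHodgeClass_algebraic_of_facts Deligne1974_ker_restrictCompl_eq_iSup_range_complexGysin_holds
    Voisin2025_hodgeClass_lift_complexGysin_holds (gysinMap_restrictCompl_eq_zero_of_field ℂ)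
    Resolution.Hironaka1964_projective_holds lefschetzOneOne_rational_holds complexOrientationFamily
    (OrientationFamily.hasPoincareDuality _) hX 1 c (h1 hX 1 c hc hs) hc (hT hX 1 c hc hs)

/-! ### Census / STRENGTHEN: typed strengthenings S⁺ and why their rigidity buys nothing here -/

/-- **S⁺₁ (every model, no normalisation)**: for EVERY Hodge model `A` (not just some normalised
one), every rational class carried by a Milnor symbol cocycle on `A` is algebraic. More rigid
(`∀ A`, NORM dropped) — but equivalent to GK: `algebraicClasses` is a `ℂ`-subspace and a rational
class that is a complex multiple of a rational algebraic class is algebraic, so the free scalar of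
`A.deRham` never matters (refuter's MUTATION note on stmt-17743). No induction/compactness gained. -/
def GKEveryModel : Prop :=
  ∀ ⦃n : ℕ⦄ ⦃X : SchemeOver ℂ⦄, IsSmoothProjective n X →
    ∀ (q : ℕ) (c : complexBetti X (2 * (q + 1))), IsRationalClass c →
      ∀ A : HodgeModel n X, A.HasSymbolCocycle q c → c ∈ algebraicClasses X (q + 1)

/-- S⁺₁ ⇒ GK (the cheap direction; the converse is the scalar argument above, not formalised). -/
theorem gkNamed_of_everyModel (h : GKEveryModel) : GKNamed :=
  fun _ _ hX q c hc hs ↦ let ⟨A, _, hS⟩ := hs; h hX q c hc A hS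

/-- **S⁺₂ (multiplicative rigidity, weight 2)**: every rational symbol class of weight `2` is a
`ℂ`-combination of cup products of DIVISOR classes. Rigid (the cup structure inducts on the
weight: `L¹ = NS`) — but FALSE wherever `Alg² ⊄ NS · NS` once `Alg ⊆ L` (support item
AlgebraicClassesAreSymbolClasses, 2001 Thm A): e.g. abelian fourfolds of Weil type whose Weil
classes are algebraic (Schoen 1988; Markman 2025). Where it is true it says nothing new. -/
def GKSpanOfDivisorProductsTwo : Prop :=
  ∀ ⦃n : ℕ⦄ ⦃X : SchemeOver ℂ⦄, IsSmoothProjective n X →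
    ∀ (c : complexBetti X (2 * (1 + 1))), IsRationalClass c → IsSymbolClass n X 1 c →
      c ∈ Submodule.span ℂ {x : complexBetti X (2 * (1 + 1)) |
        ∃ a b : complexBetti X (2 * 1), a ∈ algebraicClasses X 1 ∧ b ∈ algebraicClasses X 1 ∧
          x = cupProduct (show 2 * 1 + 2 * 1 = 2 * (1 + 1) by norm_num) a b}

/-- **S⁺₃ (uniform coniveau with the cover)**: the symbol class dies on the complement of a
Zariski-closed proper subset — Sub₁ is already the weakest form; the natural rigidification "dies
off the union of the zero/polar divisors of GLOBAL meromorphic continuations of the units" is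
not expressible (no several-variable meromorphic functions in Mathlib/tree) and, by Bloch
(Lectures, Lecture 6, p. 72: the analytic Gersten sheaves "frequently have non-trivial
cohomology so there is no obvious map `H²(X^an, 𝒦₂^an) → CH²(X)`"), has no mechanism behind it.
Recorded as prose in STRATEGY-CENSUS.md. -/
theorem strengthen_note : True := trivial

/-! ### Census / DECOMPOSITION D5: dimension induction by weak Lefschetz (typed pieces, not proved)

For `2p ≤ dim H` a rational class on `X` whose restriction to a smooth ample `H` with affine
complement is algebraic is algebraic — the crux `WeakLefschetzAlgebraicClasses` of route
`AffinePartDecay`. Symbol classes restrict to symbol classes (`SymbolClassesRestrict`, genuine and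
plausibly provable: restrict cover, units, cocycle and zigzag along the closed immersion). Hence
GK_p in dimension `≥ 2p + 1` reduces to dimension `2p`; for weight `2` everything reduces to
FOURFOLDS (`GKWeightTwoFourfolds`) — the case with no plan. Recorded to show the bottleneck is
exactly `(n, p) = (4, 2)`; not a redirect. -/

/-- Symbol classes restrict to symbol classes along a closed immersion of smooth projective
varieties (functoriality of `𝒦^M_p`-cocycles and of the Čech–de Rham zigzag). -/
def SymbolClassesRestrict : Prop :=
  ∀ ⦃n : ℕ⦄ ⦃X H : SchemeOver ℂ⦄ (i : H ⟶ X), IsSmoothProjective (n + 1) X →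
    IsSmoothProjective n H → AlgebraicGeometry.IsClosedImmersion i.left →
      ∀ (q : ℕ) (c : complexBetti X (2 * (q + 1))), IsSymbolClass (n + 1) X q c →
        IsSymbolClass n H q (complexBetti.map i (2 * (q + 1)) c)

/-- GK in the first open slice: weight `2` on fourfolds. -/
def GKWeightTwoFourfolds : Prop :=
  ∀ ⦃X : SchemeOver ℂ⦄, IsSmoothProjective 4 X → ∀ (c : complexBetti X (2 * (1 + 1))),
    IsRationalClass c → IsSymbolClass 4 X 1 c → c ∈ algebraicClasses X (1 + 1)

/-- GK ⇒ its fourfold slice (sanity: the slice is a genuine special case). -/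
theorem gkWeightTwoFourfolds_of_gkNamed (h : GKNamed) : GKWeightTwoFourfolds :=
  fun _ hX c hc hs ↦ h hX 1 c hc hs

end Summit.HodgeConjecture.HodgeConjecture.Cruxes.SymbolClassesAlgebraic.Census

end
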